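import Mathlib
import Literature.AlgebraicGeometry.CossartPiltant200819.Thm15FrameSHE2019
import Literature.AlgebraicGeometry.Resolution.LocalBlowup
import Literature.AlgebraicGeometry.Resolution.RegularLocalRingsProofs
import Literature.AlgebraicGeometry.Resolution.AffineDomainDimension
import Literature.RingTheory.Derivation.RegularRadicialCotangent
import HarnessLib

/-!
# F-110 `CossartPiltant2019_thm_1_5_i_frame` is FALSE modulo the construction of a critical witness

Negative lemma (INPUTS seat res-inputs-p-cp15frame g1, director KEY DR-IN5 (P)(ii), 2026-08-28) for the RETIRED named
statement F-110 `Literature.AlgebraicGeometry.CossartPiltant200819.CossartPiltant2019_thm_1_5_i_frame` (Cossart–Piltant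
2019, Thm 1.5 (i) with Prop 2.22 in base-side «frame» form), ruled FALSE AS TYPED by res-B-crit-1
(`B/res-B-crit-1/VERDICT-F110-challenge.md`, sha16 4f8c22baff37bd88) and res-inputs-crit-1 (R190) on the challenge of
res-B-lens-6 g3 (`Cruxes/DescentPerfectToAll/NEGATION-lens6-g3.md`, `NegationLens6g3.lean`; typed target
`NegationLens6g3.F110False := ¬ CossartPiltant2019_thm_1_5_i_frame.{0}`).  It serves the crux `CleanModels`
(stmt-ResolutionOfSingularities-15917), whose skeleton `Cruxes/CleanModels/Lines/Sketch.lean` carries F-110 verbatim as the stub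
`stub_cp2019Thm15iFrame`: that stub is unprovable.

WHAT IS PROVED HERE (0 sorry, no named fact used):

* `not_isRegularLocalRing_adjoinRoot_X_pow_sub_C_of_mem_sq` — the **regularity criterion for a degree-`p` radicial
  algebra**: over a regular local ring `B` of prime characteristic `p`, if `h ∈ 𝔪_B²` then `B[X]/(X^p - h)` is NOT a
  regular local ring (embedding dimension `dim B + 1`; the tree's `not_mem_maximalIdeal_sq_of_basis_pow` fed with the
  power basis of `AdjoinRoot`, the derivation `d/dX` — which descends because `(X^p - h)' = 0` in characteristic `p` — and
  `dim B[X]/(X^p - h) = dim B`), and its translate `not_isRegularLocalRing_adjoinRoot_X_pow_sub_C_of_sub_pow_mem_sq`: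
  if `g - e^p ∈ 𝔪_B²` for some `e ∈ B` then `B[X]/(X^p - g)` is not regular (`X ↦ X + e`).
* `CossartPiltant2019_thm_1_5_i_frame_false_of_criticalWitness` —
  `CP15FrameCriticalWitness → ¬ CossartPiltant2019_thm_1_5_i_frame.{0}`.

THE HYPOTHESIS `H := CP15FrameCriticalWitness` (a CONSTRUCTION item, `--negative-modulo`; NOT a published statement, hence
not a Literature fact): there is an instance `(p, S, K, f, O)` of ALL the hypotheses of F-110 along which every tower the
statement quantifies over (same binders, verbatim) ends CRITICALLY: the end radicand `g n` is a `p`-th power modulo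
`𝔪_{B n}²`.  Two such instances are established ON PAPER, critic-verified: (1) the GOLDEN witness of lens-6 g3 / res-B-crit-1
— `p = 5`, `S = 𝔽₅[x,y,w]_{(x,y,w)}`, `f = x²y`, `O` = (monomial valuation `μ₁(x) = 1, μ₁(y) = (1+√5)/2` of `𝔽₅(w)(x,y)`) ∘
(`w`-adic valuation of `𝔽₅(w)`); there, for every regular local `B` with `S ⊆ B ⊆ O` dominated by `O` and essentially of
finite type, no element of `K⁵(x²y)` is a regular parameter of `B` (Abhyankar 1956, Amer. J. Math. 78, Thm 3 — factorisation
of 2-dimensional birational dominations into quadratic transforms — applied to `B` localised at the centre of `μ₁`, the golden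
quadratic chain with `x²y = X_j^{m_j}Y_j^{n_j}`, `(m_j, n_j) mod 5` of period 4 avoiding 0, and either the `p`-basis
decomposition or the value character `χ(m + nφ) = m - 2n` — `5` divides no Lucas number); so an end radicand in `𝔪` lies in
`𝔪²`, and a unit end radicand has residue `c⁵` (`κ(B) = 𝔽₅` perfect) with `g - c⁵ ∈ 𝔪 ∩ K⁵(x²y) ⊆ 𝔪²`; (2) the DIVISORIAL
witness of res-inputs-crit-1 R190 (3) — same `p, S, f`, `O = ord_𝔪` (no Abhyankar): every tower member is `S`, a
`B♯ = S[v/u₀]_{𝔪_S S[v/u₀]}` or `O`, all of whose regular parameters have value `1`, while `C⁵x²y + D⁵` has value in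
`5ℤ ∪ (5ℤ + 3)`.  Building either `O` as a `ValuationSubring` of `Frac 𝔽₅[x,y,w]` and controlling every `IsLocalBlowupAlong`
tower along it is the open construction; everything downstream of it is kernel-checked below.  (The hypotheses
`IsRegularLocalRing S`, `IsExcellentRing S`, `ringKrullDim S = 3` of the witness base are in reach of the tree:
`MvPolynomial.isRegularRing_of_isRegularRing`, `isExcellentRing_of_finiteType_field` + `IsExcellentRing.of_isLocalization`.)

HONESTY: nothing here proves or refutes resolution of singularities in characteristic `p`, `CleanModels`, or rung B; the
printed Cossart–Piltant Thm 1.5 is fine (its faithful reading is `CossartPiltant2019Local`); only the typed frame shape is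
refuted, and only modulo `H`.  [OURS · NEGATIVE] F-110 stays RETIRED; on an unconditional `¬` it becomes REFUTED.
-/

noncomputable section

set_option linter.dupNamespace false -- mandated namespace of this single-conjunct summit

universe u

open Polynomial IsLocalRing
open Literature.AlgebraicGeometry.Resolution

namespace Summit.ResolutionOfSingularities.ResolutionOfSingularities.Theorems.CleanModels.Negative

/-! ## 1. The regularity criterion for `B[X]/(X^p - h)` -/

/-- **`d/dX` descends to `B[X]/(X^p - h)` in characteristic `p`**: there is a `B`-derivation `D` of
`AdjoinRoot (X^p - C h)` with `D (root) = 1`, because the derivative `p·X^{p-1}` of `X^p - C h` vanishes. [folklore] -/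
theorem exists_derivation_adjoinRoot_X_pow_sub_C {B : Type u} [CommRing B] (p : ℕ) [CharP B p] (h : B) :
    ∃ D : Derivation B (AdjoinRoot (X ^ p - C h)) (AdjoinRoot (X ^ p - C h)),
      D (AdjoinRoot.root (X ^ p - C h)) = 1 := by
  set f : B[X] := X ^ p - C h with hf
  -- the quotient map as a `B`-algebra homomorphism onto `AdjoinRoot f`
  let F : B[X] →ₐ[B] AdjoinRoot f := Polynomial.aeval (AdjoinRoot.root f)
  have hF : ∀ x, F x = AdjoinRoot.mk f x := fun x => AdjoinRoot.aeval_eq x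
  have hsurj : Function.Surjective F := by
    intro y
    obtain ⟨x, rfl⟩ := AdjoinRoot.mk_surjective y
    exact ⟨x, hF x⟩
  have hf' : derivative f = 0 := by
    rw [hf, derivative_sub, derivative_X_pow, derivative_C, sub_zero, CharP.cast_eq_zero, C_0, zero_mul]
  have hd : ∀ x, F x = 0 → F (derivative' x) = 0 := by
    intro x hx
    rw [hF, AdjoinRoot.mk_eq_zero] at hx ⊢
    obtain ⟨q, rfl⟩ := hx
    show f ∣ derivative (f * q)
    rw [derivative_mul, hf', zero_mul, zero_add]
    exact dvd_mul_right f _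
  refine ⟨Derivation.liftOfSurjective hsurj hd, ?_⟩
  have key := Derivation.liftOfSurjective_apply hsurj hd (X : B[X])
  have hFX : F X = AdjoinRoot.root f := Polynomial.aeval_X (AdjoinRoot.root f)
  rw [hFX] at key
  rw [key]
  show F (derivative X) = 1
  rw [derivative_X, map_one]

/-- **Regularity criterion (necessity of transversality).**  Let `B` be a regular local ring of prime characteristic
`p` and `h ∈ 𝔪_B²`.  Then `B[X]/(X^p - h)` is NOT a regular local ring: it is local of dimension `dim B` with maximal
ideal `(𝔪_B, x)`, `x` the class of `X`, and `x^p = h ∈ 𝔪_B²` makes its embedding dimension `dim B + 1`.  Proved through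
the tree's `Literature.RingTheory.Derivation.not_mem_maximalIdeal_sq_of_basis_pow` (power basis `1, x, …, x^{p-1}`,
derivation `d/dX` with `D x = 1`, equal dimensions). [folklore] -/
theorem not_isRegularLocalRing_adjoinRoot_X_pow_sub_C_of_mem_sq {B : Type u} [CommRing B] [IsRegularLocalRing B]
    {p : ℕ} [Fact p.Prime] [CharP B p] {h : B} (hh : h ∈ maximalIdeal B ^ 2) :
    ¬ IsRegularLocalRing (AdjoinRoot (X ^ p - C h)) := by
  intro hreg
  have hp : p.Prime := Fact.out
  set f : B[X] := X ^ p - C h with hf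
  haveI : IsDomain B := isDomain_of_isRegularLocalRing B
  have hmonic : f.Monic := monic_X_pow_sub_C h hp.ne_zero
  have hdeg : f.natDegree = p := natDegree_X_pow_sub_C
  have hdeg0 : f.degree ≠ 0 := by
    rw [hf, degree_X_pow_sub_C hp.pos]
    exact_mod_cast hp.ne_zero
  have hinj : Function.Injective (algebraMap B (AdjoinRoot f)) :=
    AdjoinRoot.of.injective_of_degree_ne_zero hdeg0
  haveI : Module.Finite B (AdjoinRoot f) := hmonic.finite_adjoinRoot
  haveI : Algebra.IsIntegral B (AdjoinRoot f) := Algebra.IsIntegral.of_finite B _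
  -- `B → B[X]/(f)` is a local homomorphism (the target is local by assumption, integral over `B`)
  have hcomap : (maximalIdeal (AdjoinRoot f)).comap (algebraMap B (AdjoinRoot f)) = maximalIdeal B :=
    IsLocalRing.eq_maximalIdeal (Ideal.isMaximal_comap_of_isIntegral_of_isMaximal _)
  haveI : IsLocalHom (algebraMap B (AdjoinRoot f)) := by
    refine ⟨fun r hr => ?_⟩
    by_contra hru
    have h1 : r ∈ maximalIdeal B := (mem_maximalIdeal _).mpr hru
    rw [← hcomap, Ideal.mem_comap] at h1
    exact (mem_maximalIdeal _).mp h1 hr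
  -- the power basis `1, x, …, x^{p-1}`, reindexed by `Fin (n + 2)` with `p = n + 2`
  obtain ⟨n, hn⟩ : ∃ n, p = n + 2 := ⟨p - 2, by have := hp.two_le; omega⟩
  let pb := AdjoinRoot.powerBasis' hmonic
  have hdim : pb.dim = n + 2 := by
    show f.natDegree = n + 2
    rw [hdeg, hn]
  let b : Module.Basis (Fin (n + 2)) B (AdjoinRoot f) := pb.basis.reindex (finCongr hdim)
  have hb : ∀ i, b i = AdjoinRoot.root f ^ (i : ℕ) := by
    intro i
    show (pb.basis.reindex (finCongr hdim)) i = AdjoinRoot.root f ^ (i : ℕ)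
    rw [Module.Basis.reindex_apply, PowerBasis.coe_basis]
    show pb.gen ^ _ = _
    rw [show pb.gen = AdjoinRoot.root f from rfl]
    simp
  -- `x^p = h` and `x ∈ 𝔪`
  have hhm : h ∈ maximalIdeal B := Ideal.pow_le_self two_ne_zero hh
  have hxp : AdjoinRoot.root f ^ (n + 2) = algebraMap B (AdjoinRoot f) h := by
    rw [← hn]
    have h0 := AdjoinRoot.eval₂_root f
    rw [hf, eval₂_sub, eval₂_X_pow, eval₂_C, sub_eq_zero] at h0
    rw [AdjoinRoot.algebraMap_eq]
    exact h0
  have hxm : AdjoinRoot.root f ∈ maximalIdeal (AdjoinRoot f) := by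
    apply (inferInstance : (maximalIdeal (AdjoinRoot f)).IsPrime).mem_of_pow_mem (n + 2)
    rw [hxp]
    exact map_nonunit (algebraMap B (AdjoinRoot f)) h hhm
  -- the derivation `d/dX` and the dimension equality
  obtain ⟨D, hD⟩ := exists_derivation_adjoinRoot_X_pow_sub_C (B := B) p h
  have hdimeq : ringKrullDim (AdjoinRoot f) = ringKrullDim B := ringKrullDim_eq_of_isIntegral hinj
  exact Literature.RingTheory.Derivation.not_mem_maximalIdeal_sq_of_basis_pow b hb hxm hxp D hD hdimeq hh

/-- **Translated criterion.**  Over a regular local ring `B` of prime characteristic `p`: if `g - e^p ∈ 𝔪_B²` for some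
`e ∈ B`, then `B[X]/(X^p - g)` is not a regular local ring — `X ↦ X + e` identifies it with `B[X]/(X^p - (g - e^p))`
(`(X + e)^p = X^p + e^p` in characteristic `p`). [folklore] -/
theorem not_isRegularLocalRing_adjoinRoot_X_pow_sub_C_of_sub_pow_mem_sq {B : Type u} [CommRing B]
    [IsRegularLocalRing B] {p : ℕ} [Fact p.Prime] [CharP B p] {g : B} (e : B)
    (hge : g - e ^ p ∈ maximalIdeal B ^ 2) : ¬ IsRegularLocalRing (AdjoinRoot (X ^ p - C g)) := by
  intro hreg
  have hp : p.Prime := Fact.out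
  haveI : IsDomain B := isDomain_of_isRegularLocalRing B
  set f₁ : B[X] := X ^ p - C g with hf₁
  set f₂ : B[X] := X ^ p - C (g - e ^ p) with hf₂
  have hdeg0 : ∀ a : B, (X ^ p - C a : B[X]).degree ≠ 0 := fun a => by
    rw [degree_X_pow_sub_C hp.pos]
    exact_mod_cast hp.ne_zero
  haveI : CharP (AdjoinRoot f₁) p :=
    charP_of_injective_algebraMap (AdjoinRoot.of.injective_of_degree_ne_zero (hdeg0 g)) p
  haveI : CharP (AdjoinRoot f₂) p :=
    charP_of_injective_algebraMap (AdjoinRoot.of.injective_of_degree_ne_zero (hdeg0 (g - e ^ p))) p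
  have hx₁ : AdjoinRoot.root f₁ ^ p = algebraMap B (AdjoinRoot f₁) g := by
    have h0 := AdjoinRoot.eval₂_root f₁
    rw [hf₁, eval₂_sub, eval₂_X_pow, eval₂_C, sub_eq_zero] at h0
    rw [AdjoinRoot.algebraMap_eq]
    exact h0
  have hx₂ : AdjoinRoot.root f₂ ^ p = algebraMap B (AdjoinRoot f₂) (g - e ^ p) := by
    have h0 := AdjoinRoot.eval₂_root f₂
    rw [hf₂, eval₂_sub, eval₂_X_pow, eval₂_C, sub_eq_zero] at h0
    rw [AdjoinRoot.algebraMap_eq]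
    exact h0
  -- `φ : B[X]/(f₂) → B[X]/(f₁)`, `x₂ ↦ x₁ - e`; `ψ : B[X]/(f₁) → B[X]/(f₂)`, `x₁ ↦ x₂ + e`
  have h1 : f₂.eval₂ (Algebra.ofId B (AdjoinRoot f₁) : B →+* AdjoinRoot f₁)
      (AdjoinRoot.root f₁ - algebraMap B (AdjoinRoot f₁) e) = 0 := by
    rw [show ((Algebra.ofId B (AdjoinRoot f₁) : B →+* AdjoinRoot f₁)) = algebraMap B (AdjoinRoot f₁) from rfl,
      hf₂, eval₂_sub, eval₂_X_pow, eval₂_C, sub_pow_char, ← map_pow, hx₁, map_sub, map_pow]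
    ring
  have h2 : f₁.eval₂ (Algebra.ofId B (AdjoinRoot f₂) : B →+* AdjoinRoot f₂)
      (AdjoinRoot.root f₂ + algebraMap B (AdjoinRoot f₂) e) = 0 := by
    rw [show ((Algebra.ofId B (AdjoinRoot f₂) : B →+* AdjoinRoot f₂)) = algebraMap B (AdjoinRoot f₂) from rfl,
      hf₁, eval₂_sub, eval₂_X_pow, eval₂_C, add_pow_char, ← map_pow, hx₂, map_sub, map_pow]
    ring
  let φ : AdjoinRoot f₂ →ₐ[B] AdjoinRoot f₁ :=
    AdjoinRoot.liftAlgHom f₂ (Algebra.ofId B (AdjoinRoot f₁)) _ h1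
  let ψ : AdjoinRoot f₁ →ₐ[B] AdjoinRoot f₂ :=
    AdjoinRoot.liftAlgHom f₁ (Algebra.ofId B (AdjoinRoot f₂)) _ h2
  have hφ : φ (AdjoinRoot.root f₂) = AdjoinRoot.root f₁ - algebraMap B (AdjoinRoot f₁) e :=
    AdjoinRoot.liftAlgHom_root f₂ _ _ h1
  have hψ : ψ (AdjoinRoot.root f₁) = AdjoinRoot.root f₂ + algebraMap B (AdjoinRoot f₂) e :=
    AdjoinRoot.liftAlgHom_root f₁ _ _ h2
  have hψφ : ψ.comp φ = AlgHom.id B (AdjoinRoot f₂) := AdjoinRoot.algHom_ext (by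
    rw [AlgHom.comp_apply, hφ, map_sub, hψ, AlgHom.commutes, AlgHom.id_apply]
    ring)
  have hφψ : φ.comp ψ = AlgHom.id B (AdjoinRoot f₁) := AdjoinRoot.algHom_ext (by
    rw [AlgHom.comp_apply, hψ, map_add, hφ, AlgHom.commutes, AlgHom.id_apply]
    ring)
  let eqv : AdjoinRoot f₁ ≃ₐ[B] AdjoinRoot f₂ := AlgEquiv.ofAlgHom ψ φ hψφ hφψ
  haveI := hreg
  haveI : IsRegularLocalRing (AdjoinRoot f₂) := IsRegularLocalRing.of_ringEquiv eqv.toRingEquiv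
  exact not_isRegularLocalRing_adjoinRoot_X_pow_sub_C_of_mem_sq hge this

/-! ## 2. The negative lemma: F-110 is false modulo a critical witness -/

/-- **`H`, the hypothesis of the negative lemma** (`--negative-modulo`; a CONSTRUCTION item — NOT a published statement,
hence not a Literature fact): a *critical witness* for F-110, i.e. data `(p, S, K, f, O)` meeting every hypothesis of
`CossartPiltant2019_thm_1_5_i_frame.{0}` (prime `p`; `S` regular local, excellent, of Krull dimension `3` and characteristic
`p`; `K = Frac S`; `f ∈ S` not a `p`-th power in `K`; `O` a valuation ring of `K` containing `S` and dominating it) such that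
EVERY tower the statement quantifies over — binders copied verbatim: `B 0 = S_{𝔪_O ∩ S}`, `g 0 = f`, all `B i ⊆ O` regular
local with `g i ∈ B i`, each step a local blowing up along a regular centre with `g (i+1) = c^p g i + d^p`, `c ≠ 0` — ends
CRITICALLY: `g n - e^p ∈ 𝔪_{B n}²` for some `e ∈ B n`.  Established on paper for the golden witness
(`p = 5`, `S = 𝔽₅[x,y,w]_{(x,y,w)}`, `f = x²y`, `O` = golden-monomial ∘ `w`-adic; lens-6 g3 memo §1 with Abhyankar 1956 Thm 3,
critic res-B-crit-1 §3) and for the divisorial witness (`O = ord_𝔪`; res-inputs-crit-1 R190 (3)); its Lean construction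
(the valuation ring and the control of all towers along it) is the open item this negative lemma is modulo. -/
def CP15FrameCriticalWitness : Prop :=
  ∃ (p : ℕ) (_ : p.Prime) (S : Type) (_ : CommRing S) (_ : IsRegularLocalRing S)
    (_ : IsExcellentRing S) (_ : ringKrullDim S = 3) (_ : CharP S p)
    (K : Type) (_ : Field K) (_ : Algebra S K) (_ : IsFractionRing S K) (f : S)
    (_ : ∀ c : K, c ^ p ≠ algebraMap S K f)
    (O : ValuationSubring K) (_ : (algebraMap S K).range ≤ O.toSubring)
    (_ : ∀ s ∈ IsLocalRing.maximalIdeal S, O.valuation (algebraMap S K s) < 1),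
    ∀ (n : ℕ) (B : ℕ → Subring K) (g : ℕ → K),
      B 0 = locAtCentre (algebraMap S K).range O → g 0 = algebraMap S K f →
      (∀ i ≤ n, B i ≤ O.toSubring ∧ IsRegularLocalRing (B i) ∧ g i ∈ B i) →
      (∀ i < n, ∃ P : Ideal (B i), IsRegularLocalRing ((B i) ⧸ P) ∧
        IsLocalBlowupAlong O (B i) P (B (i + 1)) ∧
        ∃ c d : K, c ≠ 0 ∧ g (i + 1) = c ^ p * g i + d ^ p) →
      ∀ (_ : IsRegularLocalRing (B n)) (hg : g n ∈ B n),
        ∃ e : B n, (⟨g n, hg⟩ : B n) - e ^ p ∈ IsLocalRing.maximalIdeal (B n) ^ 2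

/-- **F-110 is false modulo a critical witness.**  If `CP15FrameCriticalWitness` holds then
`Literature.AlgebraicGeometry.CossartPiltant200819.CossartPiltant2019_thm_1_5_i_frame.{0}` fails (equivalently
`NegationLens6g3.F110False`, `↔ FrameFailsAtDim 3`): apply F-110 to the witness, take the tower it produces, and refute
the END clause `IsRegularLocalRing (AdjoinRoot (X^p - C (g n)))` at the regular local ring `B n` (of characteristic `p`,
a subring of `K ⊇ S`) with the translated regularity criterion, `g n - e^p ∈ 𝔪_{B n}²`. [folklore] -/
theorem CossartPiltant2019_thm_1_5_i_frame_false_of_criticalWitness (H : CP15FrameCriticalWitness) :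
    ¬ Literature.AlgebraicGeometry.CossartPiltant200819.CossartPiltant2019_thm_1_5_i_frame.{0} := by
  intro hF
  obtain ⟨p, hp, S, _, _, hexc, hdim, hchar, K, _, _, _, f, hf, O, hSO, hdom, hcrit⟩ := H
  obtain ⟨n, B, g, hB0, hg0, hreg, hstep, hend⟩ := hF p hp S hexc hdim hchar K f hf O hSO hdom
  obtain ⟨-, hregn, hgn⟩ := hreg n le_rfl
  haveI := hregn
  haveI : Fact p.Prime := ⟨hp⟩
  haveI : CharP K p := charP_of_injective_algebraMap (IsFractionRing.injective S K) p
  haveI : CharP (B n) p := CharP.subring' K p (B n)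
  obtain ⟨e, he⟩ := hcrit n B g hB0 hg0 hreg hstep hregn hgn
  exact not_isRegularLocalRing_adjoinRoot_X_pow_sub_C_of_sub_pow_mem_sq e he (hend hgn)

end Summit.ResolutionOfSingularities.ResolutionOfSingularities.Theorems.CleanModels.Negative

end
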